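import Summits.QuantumFields.YangMills.Theorems.NPointIsotropy.Negative.NPointRegularJunk
import Summits.QuantumFields.YangMills.Theorems.PencilRigidityNPointIsotropyOffDiagDensity
import Summits.QuantumFields.YangMills.Theorems.PencilRigidityNPointIsotropyOffDiagCutoffTendsto
import Summits.QuantumFields.YangMills.Theorems.PencilRigidityNPointIsotropyLocalOffDiagDensity
import Summits.QuantumFields.YangMills.Theorems.PencilRigidityNPointIsotropyOffDiagCutoff
import Summits.QuantumFields.YangMills.Theorems.MirrorModularBoostsCurvatureBoostCovarianceDominatedTieLimitRiemannSum
import HarnessLib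

/-!
# Dominated tie limit, II: `‖T F‖ ≤ ∫ ‖F‖ w` on `⁰𝒮` from tempered lattice approximants — stub `stub_dominatedTieLimit`

Line `boosts-inherit-mirrors` of crux `MirrorModularBoosts.CurvatureBoostCovariance`
(stmt-QuantumFields-9663), Stub 1b of reshape 8 of the registered skeleton
`Cruxes/CurvatureBoostCovariance/Lines/boosts_inherit_mirrors.lean` (model-blind analysis; Step 0 of the
line, `NPointRegular`, is derived in the skeleton from Stub 1a — tempered lattice densities tied to the
Schwinger functions — via this stub and Stub 1c `stub_regular_of_dominated`).

Statement (`stub_dominatedTieLimit`, registered signature verbatim).  On `X = (ℝ⁴)ⁿ` (`n > 0`) let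
`T` be a continuous linear functional on `𝓢(X, ℂ)`, `a_k → 0⁺` lattice spacings and `L_k` half-sides
with `a_k L_k → ∞`, `D_k : (ℤ⁴)ⁿ → ℝ` lattice densities and `w ≥ 0` a measurable weight, continuous
off the coincidence locus `A = {∃ i ≠ j, yᵢ = yⱼ}` and tempered there,
`w y ≤ C (1 + ‖y‖)^N (1 + Σ_i Σ_{j ≠ i} ‖yᵢ - yⱼ‖⁻¹)^N`, with `|D_k x| ≤ w(a_k x)` at injective
multi-sites of the box for `k ≥ k₀`, and suppose the TIE: the lattice functionals
`Λ_k F = (a_k⁴)ⁿ Σ_{x ∈ boxⁿ} F(a_k x) D_k x` converge to `T F` on every off-diagonal real product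
tensor `F = ⊗ᵢ fᵢ`.  Then for every `F ∈ ⁰𝒮` (`IsOffDiagonal`: flat on `A`), `‖F‖ w ∈ L¹` and
`‖T F‖ ≤ ∫ ‖F‖ w`.

Proof.
1. *Flat decay against the pair weight* (`DominatedTieLimit.flat_decay_pairWeight`, general normed
   `E`): `(1 + ‖y‖)^α ‖G y‖ (1 + Σ_i Σ_{j≠i} ‖yᵢ - yⱼ‖⁻¹)^β ≤ 4^α (1 + n²)^β sup_{≤ (α, β+1)} ‖G‖` for
   `G ∈ ⁰𝒮`: if all inverse pair distances are `≤ 1` this is Schwartz decay; otherwise the pair with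
   the largest inverse distance `ρ > 1` bounds the double sum by `n² ρ`, and the weighted flatness
   bound `one_add_pow_mul_norm_iteratedFDeriv_le` (Taylor at the coincident point `y` with
   `y_j ↦ y_i`, at sup-distance `ρ⁻¹ ≤ 1`) supplies `ρ^{-(β+1)}`.  Hence the majorant
   `‖G y‖ w y ≤ K₀ q(G) (1 + ‖y‖)^{-8n}` with `q = sup_{≤ (N+8n, N+1)}` of Schwartz seminorms and
   `K₀ = |C| 4^{N+8n} (1 + n²)^N` (`norm_mul_weight_le`; on `A`, `G = 0`).
2. *Equicontinuity on `⁰𝒮`*: at a non-injective multi-site `a_k x ∈ A` and `G(a_k x) = 0`, so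
   `‖Λ_k G‖ ≤ (a_k⁴)ⁿ Σ_x ‖G(a_k x)‖ w(a_k x)` (`norm_latticeSum_le`), which by the majorant and the
   mesh-uniform bound of file I is `≤ K₀ 4^{4n} q(G)` for `k ≥ k₀`, `a_k ≤ 1`.
3. *Density*: `⁰𝒮 ⊆ closure (span_ℂ {off-diagonal real product tensors})` (`offDiagDensity` with
   `offDiagCutoffFamily`, `offDiagCutoffTendsto`, `localOffDiagDensity`, crux 11686 files); the span
   consists of off-diagonal functions, `Λ_k` (finite combinations of evaluations, written as continuous
   linear functionals) converge on it by linearity, and an `ε/3` argument with the equicontinuity bound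
   applied to `G - F` (`tendsto_of_mem_closure_span`) gives `Λ_k F → T F` for every `F ∈ ⁰𝒮`.
4. *Riemann sums*: `‖Λ_k F‖ ≤ (a_k⁴)ⁿ Σ_x g(a_k x)` with `g = ‖F‖ w ≥ 0`, measurable, continuous off
   `A`, `g ≤ K₀ q(F) (1 + ‖·‖)^{-8n}`; by `stub_weightedRiemannSums` (file I) `g ∈ L¹` and the right-hand
   side tends to `∫ g`, so `‖T F‖ = lim ‖Λ_k F‖ ≤ ∫ g` (`le_of_tendsto_of_tendsto`).

References: K. Osterwalder, R. Schrader, Comm. Math. Phys. 31 (1973) §2 and 42 (1975) §2 (`⁰𝒮`,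
temperedness estimates for lattice approximants); J. Glimm, A. Jaffe, Quantum Physics (1987) §9.5–9.6
(lattice approximation); L. Hörmander, ALPDO I, Lemma 7.1.8 (density of `C_c^∞` off a closed set in
the flat functions). [folklore]
-/

noncomputable section

namespace Summit.QuantumFields.YangMills.Theorems.CurvatureBoostCovariance.BoostsInheritMirrors

open scoped BigOperators SchwartzMap
open MeasureTheory Filter Topology
open Literature.MathematicalPhysics.QuantumLattice Literature.MathematicalPhysics.AQFT
open Literature.Probability.LatticeModels (box mem_box Site)
open Summit.QuantumFields.YangMills.Theorems.NPointIsotropy.Negative (E4)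
open Summit.QuantumFields.YangMills.Theorems.NPointIsotropy.ComplexRotationBandlimit

namespace DominatedTieLimit

/-! ## Flat decay of `⁰𝒮` functions against tempered pair weights -/

section Flat

variable {E : Type*} [NormedAddCommGroup E] [NormedSpace ℝ E] {n : ℕ}

/-- **Flat decay against the pair weight.** For `F ∈ ⁰𝒮(Eⁿ)` and all `α β : ℕ`, `y : Eⁿ`:
`(1 + ‖y‖)^α ‖F y‖ (1 + Σ_i Σ_{j ≠ i} ‖y_i - y_j‖⁻¹)^β ≤ 4^α (1 + n²)^β sup_{≤ (α, β+1)} ‖F‖`.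
If all inverse pair distances are `≤ 1` this is plain Schwartz decay; otherwise the pair `(i, j)`
with the largest inverse distance `ρ > 1` controls the double sum by `n² ρ`, and the weighted
flatness bound at the coincident point `y` with `y_j ↦ y_i` (at sup-distance `ρ⁻¹ ≤ 1`) gives the
factor `ρ^{-(β+1)}`. [folklore] -/
theorem flat_decay_pairWeight {F : 𝓢((Fin n → E), ℂ)} (hF : IsOffDiagonal F) (α β : ℕ)
    (y : Fin n → E) :
    (1 + ‖y‖) ^ α * ‖F y‖ * (1 + ∑ i, ∑ j ∈ Finset.univ.erase i, ‖y i - y j‖⁻¹) ^ β ≤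
      4 ^ α * (1 + (n : ℝ) ^ 2) ^ β *
        (Finset.Iic (α, β + 1)).sup (schwartzSeminormFamily ℂ (Fin n → E) ℂ) F := by
  set S := (Finset.Iic (α, β + 1)).sup (schwartzSeminormFamily ℂ (Fin n → E) ℂ) F with hS
  have hS0 : 0 ≤ S := apply_nonneg _ _
  have hσ0 : 0 ≤ ∑ i, ∑ j ∈ Finset.univ.erase i, ‖y i - y j‖⁻¹ :=
    Finset.sum_nonneg fun i _ => Finset.sum_nonneg fun j _ => inv_nonneg.2 (norm_nonneg _)
  -- plain Schwartz decay
  have hdec : (1 + ‖y‖) ^ α * ‖F y‖ ≤ 4 ^ α * S := by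
    have h : (1 + ‖y‖) ^ α * ‖iteratedFDeriv ℝ 0 F y‖ ≤ 2 ^ α * S :=
      SchwartzMap.one_add_le_sup_seminorm_apply (𝕜 := ℂ) (m := (α, β + 1)) (k := α) (n := 0)
        le_rfl (by simp) F y
    rw [norm_iteratedFDeriv_zero] at h
    refine h.trans (mul_le_mul_of_nonneg_right ?_ hS0)
    exact pow_le_pow_left₀ (by norm_num) (by norm_num) α
  by_cases hsmall : ∀ i j : Fin n, i ≠ j → ‖y i - y j‖⁻¹ ≤ 1
  · have hσ : ∑ i, ∑ j ∈ Finset.univ.erase i, ‖y i - y j‖⁻¹ ≤ (n : ℝ) ^ 2 := by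
      calc ∑ i, ∑ j ∈ Finset.univ.erase i, ‖y i - y j‖⁻¹
          ≤ ∑ i, ∑ j ∈ Finset.univ.erase i, (1 : ℝ) := Finset.sum_le_sum fun i _ =>
            Finset.sum_le_sum fun j hj => hsmall i j (Finset.mem_erase.1 hj).1.symm
        _ ≤ ∑ _i : Fin n, ∑ _j : Fin n, (1 : ℝ) := Finset.sum_le_sum fun i _ =>
            Finset.sum_le_sum_of_subset_of_nonneg (Finset.erase_subset _ _) fun _ _ _ => zero_le_one
        _ = (n : ℝ) ^ 2 := by
            simp only [Finset.sum_const, Finset.card_univ, Fintype.card_fin, nsmul_eq_mul, mul_one]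
            ring
    calc (1 + ‖y‖) ^ α * ‖F y‖ * (1 + ∑ i, ∑ j ∈ Finset.univ.erase i, ‖y i - y j‖⁻¹) ^ β
        ≤ 4 ^ α * S * (1 + (n : ℝ) ^ 2) ^ β :=
          mul_le_mul hdec (pow_le_pow_left₀ (by positivity) (by linarith) β) (by positivity)
            (by positivity)
      _ = 4 ^ α * (1 + (n : ℝ) ^ 2) ^ β * S := by ring
  · push Not at hsmall
    obtain ⟨i₁, j₁, hij₁, hbig⟩ := hsmall
    obtain ⟨q, hq, hmax⟩ := Finset.exists_max_image
      (Finset.univ.filter fun q : Fin n × Fin n => q.1 ≠ q.2) (fun q => ‖y q.1 - y q.2‖⁻¹)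
      ⟨(i₁, j₁), by simpa using hij₁⟩
    have hq' : q.1 ≠ q.2 := by simpa using hq
    have hρ1 : 1 < ‖y q.1 - y q.2‖⁻¹ := hbig.trans_le (hmax (i₁, j₁) (by simpa using hij₁))
    have hρ0 : 0 < ‖y q.1 - y q.2‖⁻¹ := one_pos.trans hρ1
    have hδ0 : 0 < ‖y q.1 - y q.2‖ := inv_pos.1 hρ0
    have hδ1 : ‖y q.1 - y q.2‖ ≤ 1 := by
      have h := inv_le_one_of_one_le₀ hρ1.le
      rwa [inv_inv] at h
    -- the double sum is at most `n² ρ`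
    have hσ : ∑ i, ∑ j ∈ Finset.univ.erase i, ‖y i - y j‖⁻¹ ≤ (n : ℝ) ^ 2 * ‖y q.1 - y q.2‖⁻¹ := by
      calc ∑ i, ∑ j ∈ Finset.univ.erase i, ‖y i - y j‖⁻¹
          ≤ ∑ i, ∑ j ∈ Finset.univ.erase i, ‖y q.1 - y q.2‖⁻¹ := Finset.sum_le_sum fun i _ =>
            Finset.sum_le_sum fun j hj => hmax (i, j)
              (Finset.mem_filter.2 ⟨Finset.mem_univ _, (Finset.mem_erase.1 hj).1.symm⟩)
        _ ≤ ∑ _i : Fin n, ∑ _j : Fin n, ‖y q.1 - y q.2‖⁻¹ := Finset.sum_le_sum fun i _ =>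
            Finset.sum_le_sum_of_subset_of_nonneg (Finset.erase_subset _ _) fun _ _ _ => hρ0.le
        _ = (n : ℝ) ^ 2 * ‖y q.1 - y q.2‖⁻¹ := by
            simp only [Finset.sum_const, Finset.card_univ, Fintype.card_fin, nsmul_eq_mul]
            ring
    have hu : 1 + ∑ i, ∑ j ∈ Finset.univ.erase i, ‖y i - y j‖⁻¹ ≤
        (1 + (n : ℝ) ^ 2) * ‖y q.1 - y q.2‖⁻¹ := by
      have h := hρ1.le
      nlinarith
    -- weighted flatness at the coincident point `y` with `y_{q.2} ↦ y_{q.1}`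
    have hflat : (1 + ‖y‖) ^ α * ‖F y‖ ≤ 4 ^ α * S * ‖y q.1 - y q.2‖ ^ (β + 1) := by
      have hyz : ‖y - Function.update y q.2 (y q.1)‖ ≤ 1 := by
        rw [norm_sub_update_eq, norm_sub_rev]; exact hδ1
      have h := one_add_pow_mul_norm_iteratedFDeriv_le hF (update_mem_coincidenceLocus hq' y) hyz α
        (m := 0) (M := β) (p := β + 1) (by simp)
      rwa [norm_iteratedFDeriv_zero, norm_sub_update_eq, norm_sub_rev] at h
    calc (1 + ‖y‖) ^ α * ‖F y‖ * (1 + ∑ i, ∑ j ∈ Finset.univ.erase i, ‖y i - y j‖⁻¹) ^ β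
        ≤ 4 ^ α * S * ‖y q.1 - y q.2‖ ^ (β + 1) * ((1 + (n : ℝ) ^ 2) * ‖y q.1 - y q.2‖⁻¹) ^ β :=
          mul_le_mul hflat (pow_le_pow_left₀ (by positivity) hu β) (by positivity) (by positivity)
      _ = 4 ^ α * (1 + (n : ℝ) ^ 2) ^ β * S *
            (‖y q.1 - y q.2‖ * (‖y q.1 - y q.2‖ * ‖y q.1 - y q.2‖⁻¹) ^ β) := by
          rw [mul_pow, mul_pow]; ring
      _ = 4 ^ α * (1 + (n : ℝ) ^ 2) ^ β * S * ‖y q.1 - y q.2‖ := by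
          rw [mul_inv_cancel₀ hδ0.ne', one_pow, mul_one]
      _ ≤ 4 ^ α * (1 + (n : ℝ) ^ 2) ^ β * S := mul_le_of_le_one_right (by positivity) hδ1

/-- **Flat `⁰𝒮` functions against a tempered pair weight decay like a Japanese bracket.** If
`w y ≤ C (1 + ‖y‖)^N (1 + Σ_i Σ_{j ≠ i} ‖y_i - y_j‖⁻¹)^N` off the coincidence locus, then for every
`F ∈ ⁰𝒮(Eⁿ)`, every `M` and every `y`:
`‖F y‖ w y ≤ |C| 4^{N+M} (1 + n²)^N sup_{≤ (N+M, N+1)} ‖F‖ · (1 + ‖y‖)^{-M}` (on the locus `F y = 0`).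
[folklore] -/
theorem norm_mul_weight_le {F : 𝓢((Fin n → E), ℂ)} (hF : IsOffDiagonal F) {w : (Fin n → E) → ℝ}
    {C : ℝ} {N : ℕ}
    (hwC : ∀ y ∉ coincidenceLocus n E,
      w y ≤ C * (1 + ‖y‖) ^ N * (1 + ∑ i, ∑ j ∈ Finset.univ.erase i, ‖y i - y j‖⁻¹) ^ N)
    (M : ℕ) (y : Fin n → E) :
    ‖F y‖ * w y ≤ |C| * 4 ^ (N + M) * (1 + (n : ℝ) ^ 2) ^ N *
      (Finset.Iic (N + M, N + 1)).sup (schwartzSeminormFamily ℂ (Fin n → E) ℂ) F *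
        ((1 + ‖y‖) ^ M)⁻¹ := by
  have hS0 : 0 ≤ (Finset.Iic (N + M, N + 1)).sup (schwartzSeminormFamily ℂ (Fin n → E) ℂ) F :=
    apply_nonneg _ _
  by_cases hy : y ∈ coincidenceLocus n E
  · rw [hF.apply_eq_zero hy, norm_zero, zero_mul]
    positivity
  · have hA := flat_decay_pairWeight hF (N + M) N y
    have hσ0 : 0 ≤ ∑ i, ∑ j ∈ Finset.univ.erase i, ‖y i - y j‖⁻¹ :=
      Finset.sum_nonneg fun i _ => Finset.sum_nonneg fun j _ => inv_nonneg.2 (norm_nonneg _)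
    have hw : w y ≤ |C| * (1 + ‖y‖) ^ N * (1 + ∑ i, ∑ j ∈ Finset.univ.erase i, ‖y i - y j‖⁻¹) ^ N :=
      (hwC y hy).trans (by gcongr; exact le_abs_self C)
    have hpos : 0 < (1 + ‖y‖) ^ M := by positivity
    rw [← div_eq_mul_inv, le_div_iff₀ hpos]
    calc ‖F y‖ * w y * (1 + ‖y‖) ^ M
        ≤ ‖F y‖ * (|C| * (1 + ‖y‖) ^ N *
            (1 + ∑ i, ∑ j ∈ Finset.univ.erase i, ‖y i - y j‖⁻¹) ^ N) * (1 + ‖y‖) ^ M := by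
          gcongr
      _ = |C| * ((1 + ‖y‖) ^ (N + M) * ‖F y‖ *
            (1 + ∑ i, ∑ j ∈ Finset.univ.erase i, ‖y i - y j‖⁻¹) ^ N) := by
          rw [pow_add]; ring
      _ ≤ |C| * (4 ^ (N + M) * (1 + (n : ℝ) ^ 2) ^ N *
            (Finset.Iic (N + M, N + 1)).sup (schwartzSeminormFamily ℂ (Fin n → E) ℂ) F) :=
          mul_le_mul_of_nonneg_left hA (abs_nonneg C)
      _ = _ := by ring

end Flat

/-! ## Lattice sums of `⁰𝒮` functions against tempered densities -/

section Lattice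

variable {n : ℕ}

/-- **Lattice sums are dominated by the weight.** If `|D x| ≤ w(a x)` at injective multi-sites of the
box, then for `G ∈ ⁰𝒮` (which vanishes at the non-injective ones, whose scaled images are coincident)
`‖Σ_{x ∈ boxⁿ} G(a x) D x‖ ≤ Σ_{x ∈ boxⁿ} ‖G(a x)‖ w(a x)`. [folklore] -/
theorem norm_latticeSum_le (G : 𝓢((Fin n → E4), ℂ)) (hG : IsOffDiagonal G) (a : ℝ) (L : ℕ)
    (D : (Fin n → Site 4) → ℝ) (w : (Fin n → E4) → ℝ)
    (hD : ∀ x : Fin n → Site 4, (∀ i, x i ∈ box 4 L) → Function.Injective x →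
      |D x| ≤ w (fun i => a • siteToE (x i))) :
    ‖∑ x ∈ Fintype.piFinset (fun _ : Fin n => box 4 L), G (fun i => a • siteToE (x i)) * (D x : ℂ)‖ ≤
      ∑ x ∈ Fintype.piFinset (fun _ : Fin n => box 4 L),
        ‖G (fun i => a • siteToE (x i))‖ * w (fun i => a • siteToE (x i)) := by
  refine (norm_sum_le _ _).trans (Finset.sum_le_sum fun x hx => ?_)
  rw [norm_mul, Complex.norm_real, Real.norm_eq_abs]
  by_cases hinj : Function.Injective x
  · exact mul_le_mul_of_nonneg_left (hD x (fun i => Fintype.mem_piFinset.1 hx i) hinj) (norm_nonneg _)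
  · have hmem : (fun i => a • siteToE (x i)) ∈ coincidenceLocus n E4 := by
      simp only [Function.Injective, not_forall, exists_prop] at hinj
      obtain ⟨i, j, hij, hne⟩ := hinj
      exact ⟨i, j, hne, by simp [hij]⟩
    rw [hG.apply_eq_zero hmem, norm_zero, zero_mul, zero_mul]

end Lattice

/-! ## Passing pointwise convergence to the closed span -/

section Closure

variable {X : Type*} [NormedAddCommGroup X] [NormedSpace ℝ X]

/-- **Convergence on generators + equicontinuity on a class `P` ⇒ convergence on the closed span
(within `P`).** Let `Λ_k, T` be (continuous) linear functionals on `𝓢(X, ℂ)`, `P` a class of test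
functions closed under differences and containing the span of `s`, with the equicontinuity bound
`‖Λ_k G‖ ≤ K q(G)` eventually for each `G ∈ P` (`q` a finite sup of Schwartz seminorms). If
`Λ_k G → T G` for every `G ∈ s`, then `Λ_k F → T F` for every `F ∈ P` in the closure of the span of `s`
(`ε/3` argument). [folklore] -/
theorem tendsto_of_mem_closure_span (T : 𝓢(X, ℂ) →L[ℂ] ℂ) (Λ : ℕ → 𝓢(X, ℂ) →L[ℂ] ℂ)
    (P : 𝓢(X, ℂ) → Prop) (hPsub : ∀ G H, P G → P H → P (G - H)) (m : ℕ × ℕ) {K : ℝ} (hK : 0 ≤ K)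
    (hbound : ∀ G, P G → ∀ᶠ k in atTop,
      ‖Λ k G‖ ≤ K * (Finset.Iic m).sup (schwartzSeminormFamily ℂ X ℂ) G)
    (s : Set 𝓢(X, ℂ)) (hsP : ∀ G ∈ Submodule.span ℂ s, P G)
    (hs : ∀ G ∈ s, Tendsto (fun k => Λ k G) atTop (𝓝 (T G))) {F : 𝓢(X, ℂ)} (hF : P F)
    (hFmem : F ∈ closure (Submodule.span ℂ s : Set 𝓢(X, ℂ))) :
    Tendsto (fun k => Λ k F) atTop (𝓝 (T F)) := by
  -- convergence on the span, by linearity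
  have hspan : ∀ G ∈ Submodule.span ℂ s, Tendsto (fun k => Λ k G) atTop (𝓝 (T G)) := by
    intro G hG
    induction hG using Submodule.span_induction with
    | mem G hG => exact hs G hG
    | zero => simp only [map_zero]; exact tendsto_const_nhds
    | add G H _ _ hG hH => simp only [map_add]; exact hG.add hH
    | smul c G _ hG => simp only [map_smul, smul_eq_mul]; exact hG.const_mul c
  rw [Metric.tendsto_nhds]
  intro ε hε
  obtain ⟨δ, hδ, hδε⟩ : ∃ δ : ℝ, 0 < δ ∧ 3 * δ ≤ ε := ⟨ε / 3, by positivity, by linarith⟩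
  -- a neighbourhood of `F` on which `q(· - F)` and `T · - T F` are small
  have hU : {G : 𝓢(X, ℂ) | (Finset.Iic m).sup (schwartzSeminormFamily ℂ X ℂ) (G - F) < δ / (K + 1)} ∩
      {G : 𝓢(X, ℂ) | dist (T G) (T F) < δ} ∈ 𝓝 F := by
    refine Filter.inter_mem ?_ ?_
    · exact ((schwartz_withSeminorms ℂ X ℂ).mem_nhds_iff F _).2
        ⟨Finset.Iic m, δ / (K + 1), by positivity, fun G hG => by simpa [Seminorm.mem_ball] using hG⟩
    · exact T.continuous.continuousAt.preimage_mem_nhds (Metric.ball_mem_nhds (T F) hδ)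
  obtain ⟨G, ⟨hGq, hGT⟩, hGs⟩ := mem_closure_iff_nhds.1 hFmem _ hU
  have h1 : ∀ᶠ k in atTop, ‖Λ k (G - F)‖ ≤
      K * (Finset.Iic m).sup (schwartzSeminormFamily ℂ X ℂ) (G - F) :=
    hbound _ (hPsub G F (hsP G hGs) hF)
  have h2 : ∀ᶠ k in atTop, dist (Λ k G) (T G) < δ := Metric.tendsto_nhds.1 (hspan G hGs) δ hδ
  filter_upwards [h1, h2] with k hk1 hk2
  have hk1' : dist (Λ k F) (Λ k G) < δ := by
    rw [dist_comm, dist_eq_norm, ← map_sub]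
    refine hk1.trans_lt ?_
    calc K * (Finset.Iic m).sup (schwartzSeminormFamily ℂ X ℂ) (G - F) ≤ K * (δ / (K + 1)) :=
          mul_le_mul_of_nonneg_left hGq.le hK
      _ < δ := by
          rw [mul_div_assoc', div_lt_iff₀ (by positivity)]
          nlinarith
  calc dist (Λ k F) (T F) ≤ dist (Λ k F) (Λ k G) + dist (Λ k G) (T G) + dist (T G) (T F) :=
        dist_triangle4 _ _ _ _
    _ < δ + δ + δ := add_lt_add (add_lt_add hk1' hk2) hGT
    _ ≤ ε := by linarith

end Closure

end DominatedTieLimit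

/-! ## The registered stub -/

/-- **Stub 1b — THE DOMINATED TIE LIMIT (model-blind analysis; registered signature of reshape 8 of the
skeleton `Cruxes/CurvatureBoostCovariance/Lines/boosts_inherit_mirrors.lean`, verbatim).**  If tempered
lattice densities `D_k` (dominated at injective multi-sites by a weight `w ≥ 0`, measurable, continuous
and tempered off the coincidence locus) have Riemann sums `(a_k⁴)ⁿ Σ_{x ∈ boxⁿ} F(a_k x) D_k x → T F`
on the off-diagonal real product tensors, then `‖F‖ w ∈ L¹` and `‖T F‖ ≤ ∫ ‖F‖ w` for every `F ∈ ⁰𝒮`.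
Proof: flat decay against the pair weight ⇒ equicontinuity of the lattice functionals on `⁰𝒮` ⇒
convergence on all of `⁰𝒮` by the density of the off-diagonal tensors (`offDiagDensity`) ⇒ domination
by the Riemann sums of `‖F‖ w`, which converge to `∫ ‖F‖ w` (file I). -/
theorem stub_dominatedTieLimit :
    open Literature.MathematicalPhysics.QuantumLattice Literature.MathematicalPhysics.AQFT
      Literature.Probability.LatticeModels
      Summit.QuantumFields.YangMills.Theorems.NPointIsotropy.Negative in
    ∀ (n : ℕ), 0 < n → ∀ (T : SchwartzMap (Fin n → E4) ℂ →L[ℂ] ℂ) (a : ℕ → ℝ) (L : ℕ → ℕ)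
      (D : ℕ → (Fin n → Site 4) → ℝ) (w : (Fin n → E4) → ℝ) (C : ℝ) (N k₀ : ℕ),
      (∀ k, 0 < a k) → Filter.Tendsto a Filter.atTop (nhds 0) →
      Filter.Tendsto (fun k => a k * L k) Filter.atTop Filter.atTop →
      Measurable w → ContinuousOn w (coincidenceLocus n E4)ᶜ → (∀ y, 0 ≤ w y) →
      (∀ y ∉ coincidenceLocus n E4,
        w y ≤ C * (1 + ‖y‖) ^ N * (1 + ∑ i, ∑ j ∈ Finset.univ.erase i, ‖y i - y j‖⁻¹) ^ N) →
      (∀ k, k₀ ≤ k → ∀ x : Fin n → Site 4, (∀ i, x i ∈ box 4 (L k)) → Function.Injective x →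
        |D k x| ≤ w (fun i => a k • siteToE (x i))) →
      (∀ (f : Fin n → SchwartzMap E4 ℝ) (F : SchwartzMap (Fin n → E4) ℂ),
        IsTensorOf F (fun i => ofRealTest (f i)) → IsOffDiagonal F →
        Filter.Tendsto (fun k => (((a k ^ 4) ^ n * ∑ x ∈ Fintype.piFinset (fun _ : Fin n => box 4 (L k)),
          (∏ i, f i (a k • siteToE (x i))) * D k x : ℝ) : ℂ)) Filter.atTop (nhds (T F))) →
      ∀ F : SchwartzMap (Fin n → E4) ℂ, IsOffDiagonal F →
        MeasureTheory.Integrable (fun y : Fin n → E4 => ‖F y‖ * w y) ∧ ‖T F‖ ≤ ∫ y : Fin n → E4, ‖F y‖ * w y := by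
  intro n hn T a L D w C N k₀ ha ha0 haL hwm hwc hw0 hwC hD htie F hF
  -- the decay exponent `M = 8n > 4n = dim` and the constants
  set M : ℕ := 8 * n
  set q : Seminorm ℂ 𝓢((Fin n → E4), ℂ) :=
    (Finset.Iic (N + M, N + 1)).sup (schwartzSeminormFamily ℂ (Fin n → E4) ℂ)
  set K₀ : ℝ := |C| * 4 ^ (N + M) * (1 + (n : ℝ) ^ 2) ^ N
  -- (B) pointwise majorant `‖G y‖ w y ≤ K₀ q(G) (1 + ‖y‖)^{-M}` for `G ∈ ⁰𝒮`
  have hB : ∀ G : 𝓢((Fin n → E4), ℂ), IsOffDiagonal G → ∀ y,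
      ‖G y‖ * w y ≤ K₀ * q G * ((1 + ‖y‖) ^ M)⁻¹ := fun G hG y =>
    DominatedTieLimit.norm_mul_weight_le hG hwC M y
  -- the lattice functionals `Λ_k G = (a_k⁴)ⁿ Σ_{x ∈ boxⁿ} G(a_k x) D_k x`
  set ev : (Fin n → E4) → 𝓢((Fin n → E4), ℂ) →L[ℂ] ℂ := fun y =>
    (BoundedContinuousFunction.evalCLM ℂ y).comp
      (SchwartzMap.toBoundedContinuousFunctionCLM ℂ (Fin n → E4) ℂ) with hev
  set Λ : ℕ → 𝓢((Fin n → E4), ℂ) →L[ℂ] ℂ := fun k =>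
    (((a k ^ 4) ^ n : ℝ) : ℂ) • ∑ x ∈ Fintype.piFinset (fun _ : Fin n => box 4 (L k)),
      (D k x : ℂ) • ev (fun i => a k • siteToE (x i)) with hΛ
  have hΛapply : ∀ k G, Λ k G = (((a k ^ 4) ^ n : ℝ) : ℂ) *
      ∑ x ∈ Fintype.piFinset (fun _ : Fin n => box 4 (L k)),
        G (fun i => a k • siteToE (x i)) * (D k x : ℂ) := by
    intro k G
    simp only [hΛ, hev, smul_apply, FunLike.coe_sum, Finset.sum_apply,
      ContinuousLinearMap.comp_apply, BoundedContinuousFunction.evalCLM_apply, smul_eq_mul]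
    congr 1
    exact Finset.sum_congr rfl fun x _ => mul_comm _ _
  -- `‖Λ_k G‖ ≤ (a_k⁴)ⁿ Σ ‖G(a_k x)‖ w(a_k x)` for `k ≥ k₀`
  have hΛle : ∀ G : 𝓢((Fin n → E4), ℂ), IsOffDiagonal G → ∀ k, k₀ ≤ k →
      ‖Λ k G‖ ≤ (a k ^ 4) ^ n * ∑ x ∈ Fintype.piFinset (fun _ : Fin n => box 4 (L k)),
        ‖G (fun i => a k • siteToE (x i))‖ * w (fun i => a k • siteToE (x i)) := by
    intro G hG k hk
    have hak : 0 ≤ (a k ^ 4) ^ n := by have := ha k; positivity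
    rw [hΛapply, norm_mul, Complex.norm_real, Real.norm_of_nonneg hak]
    exact mul_le_mul_of_nonneg_left
      (DominatedTieLimit.norm_latticeSum_le G hG (a k) (L k) (D k) w (hD k hk)) hak
  -- equicontinuity on `⁰𝒮`: `‖Λ_k G‖ ≤ K₀ 4^{4n} q(G)` eventually
  have hequi : ∀ G : 𝓢((Fin n → E4), ℂ), IsOffDiagonal G → ∀ᶠ k in atTop,
      ‖Λ k G‖ ≤ K₀ * 4 ^ (4 * n) * q G := by
    intro G hG
    filter_upwards [eventually_ge_atTop k₀, ha0.eventually (eventually_le_nhds zero_lt_one)]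
      with k hk hk1
    refine (hΛle G hG k hk).trans ?_
    have h := DominatedTieLimit.latticeSum_majorant_le (ha k) hk1 (L k) (K := K₀ * q G)
      (by positivity) (fun y => ‖G y‖ * w y) (hB G hG)
    exact h.trans_eq (by ring)
  -- the generators: off-diagonal real product tensors, on which `Λ_k → T` by the tie
  set gens : Set 𝓢((Fin n → E4), ℂ) := {P | ∃ f : Fin n → 𝓢(E4, ℝ),
    IsTensorOf P (fun i => ofRealTest (f i)) ∧ IsOffDiagonal P}
  have hgen : ∀ G ∈ gens, Tendsto (fun k => Λ k G) atTop (𝓝 (T G)) := by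
    rintro G ⟨f, hP, hPoff⟩
    refine (htie f G hP hPoff).congr fun k => ?_
    rw [hΛapply]
    push_cast
    refine congrArg _ (Finset.sum_congr rfl fun x _ => ?_)
    rw [hP]
    simp only [ofRealTest_apply]
  have hspanP : ∀ G ∈ Submodule.span ℂ gens, IsOffDiagonal G := by
    intro G hG
    induction hG using Submodule.span_induction with
    | mem G hG =>
      obtain ⟨_, _, hoff⟩ := hG
      exact hoff
    | zero => exact isOffDiagonal_zero
    | add G H _ _ hG hH => exact hG.add hH
    | smul c G _ hG => exact hG.smul c
  have hPsub : ∀ G H : 𝓢((Fin n → E4), ℂ), IsOffDiagonal G → IsOffDiagonal H → IsOffDiagonal (G - H) := by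
    intro G H hG hH
    have h := hG.add (hH.smul (-1))
    rwa [neg_one_smul, ← sub_eq_add_neg] at h
  have hdense : F ∈ closure (Submodule.span ℂ gens : Set 𝓢((Fin n → E4), ℂ)) :=
    offDiagDensity offDiagCutoffFamily offDiagCutoffTendsto localOffDiagDensity n F hF
  -- (2) `Λ_k F → T F`
  have hconv : Tendsto (fun k => Λ k F) atTop (𝓝 (T F)) :=
    DominatedTieLimit.tendsto_of_mem_closure_span T Λ IsOffDiagonal hPsub (N + M, N + 1)
      (by positivity : (0 : ℝ) ≤ K₀ * 4 ^ (4 * n)) hequi gens hspanP hgen hF hdense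
  -- (3) `g = ‖F‖ w` is integrable and its Riemann sums over the exploding boxes converge to `∫ g`
  obtain ⟨hgi, -, hR⟩ := stub_weightedRiemannSums n hn (fun y => ‖F y‖ * w y) (K₀ * q F)
    (F.continuous.norm.measurable.mul hwm) (F.continuous.norm.continuousOn.mul hwc)
    (fun y => mul_nonneg (norm_nonneg _) (hw0 y)) (hB F hF)
  have hle : ∀ᶠ k in atTop, ‖Λ k F‖ ≤ (a k ^ 4) ^ n *
      ∑ x ∈ Fintype.piFinset (fun _ : Fin n => box 4 (L k)),
        ‖F (fun i => a k • siteToE (x i))‖ * w (fun i => a k • siteToE (x i)) :=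
    (eventually_ge_atTop k₀).mono fun k hk => hΛle F hF k hk
  exact ⟨hgi, le_of_tendsto_of_tendsto hconv.norm (hR a L ha ha0 haL) hle⟩

end Summit.QuantumFields.YangMills.Theorems.CurvatureBoostCovariance.BoostsInheritMirrors

end
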